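import Literature.AlgebraicGeometry.Resolution.Blowups
import Mathlib.AlgebraicGeometry.Morphisms.SchemeTheoreticallyDominant
import Mathlib.AlgebraicGeometry.Morphisms.Separated
import HarnessLib

/-!
# Schematically dense opens: extension of equalities, complements of effective Cartier divisors

Topic: `Literature/AlgebraicGeometry/Resolution`. Two elementary facts about scheme-theoretically
dominant morphisms (Mathlib's `IsSchemeTheoreticallyDominant f : f.ker = ⊥`; for the inclusion of
an open subscheme this is Görtz–Wedhorn's "schematically dense", Def. 9.18), PROVED over Mathlib
and used for the universal property of the blowing up `Bl_I(Spec R) = Proj R[It]`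
(Görtz–Wedhorn I, Prop. 13.92; follow-up to `Blowups.lean` / `AffineBlowup.lean`): uniqueness of
the morphism to the blow-up is checked on the complement of the exceptional divisor, which is
schematically dense.

* `ext_of_isSchemeTheoreticallyDominant_of_isSeparated` — morphisms `f g : X ⟶ Y` over a
  separated `Y ⟶ Z` which agree after composition with a scheme-theoretically dominant
  `ι : W ⟶ X` are equal (Görtz–Wedhorn I, Prop. 9.19 (i) ⇒ (iii), with (ii): `j♭` injective,
  i.e. Mathlib's `ker = ⊥`; Mathlib has the version for reduced `X` and dominant `ι`,
  `ext_of_isDominant_of_isSeparated`, whose proof is adapted: the equalizer is a closed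
  subscheme of `X` with trivial kernel).
* `IsEffectiveCartier.ker_ι_compl_eq_bot` / `IsEffectiveCartier.isSchemeTheoreticallyDominant_ι`
  — the open complement of an effective Cartier divisor (`Blowups.lean`) is schematically dense
  (Görtz–Wedhorn I, Lemma 9.23 (ii) ⇒ (i) with Remark 9.24 (no Noetherian hypothesis), and
  (13.19), proof of Prop. 13.91 (4): "the complement of every effective Cartier divisor … is
  schematically dense"): on an affine chart where the divisor is `V(g)` with `g` regular,
  restriction to `D(g)` is the injective localisation `A → A[1/g]`.

## Sources

* U. Görtz, T. Wedhorn, *Algebraic Geometry I*, 2nd ed. (2020), (9.5) pp. 290–292 of the held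
  copy: Def. 9.18 (schematically dense / schematically dominant), Prop. 9.19, Lemma 9.23,
  Remark 9.24; (13.19), proof of Prop. 13.91 (4).
-/

noncomputable section

open CategoryTheory CategoryTheory.Limits AlgebraicGeometry TopologicalSpace

namespace Literature.AlgebraicGeometry.Resolution

universe u

variable {W X Y Z : Scheme.{u}}

/-- **Görtz–Wedhorn I, Prop. 9.19** (scheme-theoretically dominant form): if `ι : W ⟶ X` is
scheme-theoretically dominant (`ι.ker = ⊥`, e.g. the inclusion of a schematically dense open
subscheme) and `f g : X ⟶ Y` are morphisms over a separated `s : Y ⟶ Z` with `ι ≫ f = ι ≫ g`,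
then `f = g` (the equalizer of `f` and `g` is a closed subscheme of `X` through which `ι`
factors, hence with trivial kernel, hence all of `X`). [cite: GortzWedhorn2020, Prop. 9.19] -/
theorem ext_of_isSchemeTheoreticallyDominant_of_isSeparated {f g : X ⟶ Y}
    (s : Y ⟶ Z) [IsSeparated s] (h : f ≫ s = g ≫ s)
    (ι : W ⟶ X) [IsSchemeTheoreticallyDominant ι] (hU : ι ≫ f = ι ≫ g) : f = g := by
  let X' : Over Z := Over.mk (f ≫ s)
  let Y' : Over Z := Over.mk s
  let U' : Over Z := Over.mk (ι ≫ f ≫ s)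
  let f' : X' ⟶ Y' := Over.homMk f
  let g' : X' ⟶ Y' := Over.homMk g h.symm
  let ι' : U' ⟶ X' := Over.homMk ι
  have : IsSeparated Y'.hom := ‹_›
  have hι : ι' ≫ f' = ι' ≫ g' := by ext1; exact hU
  have hker : (equalizer.ι f' g').left.ker = ⊥ := by
    have h1 := Scheme.Hom.le_ker_comp (equalizer.lift ι' hι).left (equalizer.ι f' g').left
    rw [← Over.comp_left, equalizer.lift_ι] at h1
    have h2 : Scheme.Hom.ker ι'.left = ⊥ := IsSchemeTheoreticallyDominant.ker_eq_bot ι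
    exact le_bot_iff.mp (h1.trans h2.le)
  have := (IsClosedImmersion.isIso_iff_ker_eq_bot (f := (equalizer.ι f' g').left)).mpr hker
  apply (cancel_epi (equalizer.ι f' g').left).mp
  exact congr($(equalizer.condition f' g').left)

/-- **The complement of an effective Cartier divisor is schematically dense** (Görtz–Wedhorn I,
Lemma 9.23 (ii) ⇒ (i) with Remark 9.24; used in (13.19), proof of Prop. 13.91 (4)): the open
immersion of
the complement of `V(J)`, for `J` an effective Cartier ideal sheaf, has trivial kernel — on an
affine chart `U` with `J(U) = (g)`, `g` regular, restricting a section to `D(g) ⊆ U ∖ V(J)` is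
the injective localisation `Γ(X, U) → Γ(X, U)[1/g]`. [cite: GortzWedhorn2020, Remark 9.24] -/
theorem IsEffectiveCartier.ker_ι_compl_eq_bot {J : X.IdealSheafData} (hJ : IsEffectiveCartier J) :
    (Scheme.Opens.ι ⟨(J.support : Set X)ᶜ, J.support.isClosed.isOpen_compl⟩).ker = ⊥ := by
  set U : X.Opens := ⟨(J.support : Set X)ᶜ, J.support.isClosed.isOpen_compl⟩
  -- the effective-Cartier charts
  choose V hxV g hg hJV using hJ
  have hcover : ⨆ x, (V x : X.Opens) = ⊤ :=
    top_le_iff.mp fun x _ => Opens.mem_iSup.mpr ⟨x, hxV x⟩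
  refine Scheme.IdealSheafData.ext_of_iSup_eq_top V hcover fun x => ?_
  rw [Scheme.IdealSheafData.ideal_bot, Pi.bot_apply, ← le_bot_iff]
  refine (Scheme.Hom.ideal_ker_le _ _).trans ?_
  rw [le_bot_iff, RingHom.ker_eq_bot_iff_eq_zero]
  intro s hs
  -- `D(g x) ⊆ U ∩ V x`
  have hle : X.basicOpen (g x) ≤ U.ι ''ᵁ (U.ι ⁻¹ᵁ (V x : X.Opens)) := by
    rw [Scheme.Hom.image_preimage_eq_opensRange_inf, Scheme.Opens.opensRange_ι]
    intro y hy
    refine ⟨?_, X.basicOpen_le _ hy⟩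
    change y ∉ (J.support : Set X)
    intro hyJ
    have : y ∈ (J.support : Set X) ∩ (V x : X.Opens) := ⟨hyJ, X.basicOpen_le _ hy⟩
    rw [Scheme.IdealSheafData.coe_support_inter] at this
    exact (X.mem_zeroLocus_iff _ y).mp this.1 (g x)
      (by rw [hJV]; exact Ideal.mem_span_singleton_self _) hy
  -- restricting further to `D(g x)` is the injective localisation at the regular element `g x`
  have hinj : Function.Injective (X.presheaf.map (homOfLE (X.basicOpen_le (g x))).op) := by
    have := (V x).2.isLocalization_basicOpen (g x)
    exact IsLocalization.injective (M := Submonoid.powers (g x)) Γ(X, X.basicOpen (g x))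
      (Submonoid.powers_le.mpr (hg x))
  apply hinj
  rw [map_zero]
  have e : X.presheaf.map (homOfLE (X.basicOpen_le (g x))).op =
      U.ι.app (V x) ≫ X.presheaf.map (homOfLE hle).op := by
    rw [Scheme.Opens.ι_app]
    erw [← Functor.map_comp]
    rfl
  rw [e, CommRingCat.comp_apply, hs, map_zero]

/-- The inclusion of the complement of an effective Cartier divisor is scheme-theoretically
dominant. [cite: GortzWedhorn2020, Remark 9.24] -/
theorem IsEffectiveCartier.isSchemeTheoreticallyDominant_ι {J : X.IdealSheafData}
    (hJ : IsEffectiveCartier J) :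
    IsSchemeTheoreticallyDominant
      (Scheme.Opens.ι ⟨(J.support : Set X)ᶜ, J.support.isClosed.isOpen_compl⟩) :=
  ⟨hJ.ker_ι_compl_eq_bot⟩

/-- Hence: two morphisms `f g : X ⟶ Y` over a separated `Y ⟶ Z` which agree on the complement
of an effective Cartier divisor of `X` are equal (the uniqueness half of the universal property
of blow-ups is checked away from the exceptional divisor; GW (13.19)).
[cite: GortzWedhorn2020, Prop. 9.19 with Remark 9.24] -/
theorem IsEffectiveCartier.ext_of_isSeparated {J : X.IdealSheafData} (hJ : IsEffectiveCartier J)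
    {f g : X ⟶ Y} (s : Y ⟶ Z) [IsSeparated s] (h : f ≫ s = g ≫ s)
    (hU : (Scheme.Opens.ι ⟨(J.support : Set X)ᶜ, J.support.isClosed.isOpen_compl⟩) ≫ f =
      (Scheme.Opens.ι ⟨(J.support : Set X)ᶜ, J.support.isClosed.isOpen_compl⟩) ≫ g) :
    f = g :=
  haveI := hJ.isSchemeTheoreticallyDominant_ι
  ext_of_isSchemeTheoreticallyDominant_of_isSeparated s h _ hU

end Literature.AlgebraicGeometry.Resolution
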